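import Literature.Geometry.Lorentzian.PenroseRigidity
import Literature.Geometry.Lorentzian.OutermostHorizonSmooth
import Literature.Geometry.Lorentzian.MinimalGraphMaximumPrinciple
import Literature.Geometry.Lorentzian.MinimalGraphMaximumPrincipleProofs
import Literature.Geometry.Lorentzian.MinimalGraphOperatorHolds
import HarnessLib

/-!
# The case of equality of the Riemannian Penrose inequality with smooth normal: the corrected
# statement reduced to Bray's Theorems 19 and 9 (family `gr`, statement **gr.S09**; namespace
# `Literature.Geometry.Lorentzian`)

This file closes, for the rigidity fact `riemannian_penrose_rigidity_smooth` of
`PenroseRigidity.lean` (the corrected statement of the case of equality of Bray, J. Differential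
Geom. 59 (2001) 177–267 = arXiv:math/9911173, Thm. 1 (p. 185) and Thm. 19 (p. 240), with the
outermost hypothesis in the form `IsMinimalSurfaceFree D.h S.exterior` and a *smooth* unit normal
`S.ν`), the gap which the module docstring of `PenroseRigidity.lean` (section "The corrected
statement") records in prose only — "the two parenthetical steps (boundary maximum principle,
invariance of domain) have no counterpart in the tree yet" — exactly as `OutermostHorizonSmooth.lean`
closes it for the inequality `riemannian_penrose_inequality_smooth`; and it carries the case of
equality with the outermost hypothesis **in printed form** as theorems conditional on the
exterior-region facts. It **proves**:

* `OutermostMOTS.isMinimalSurfaceImage_subset_range_of_isMinimalSurfaceFree` — the geometric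
  core, shared by the inequality and the case of equality: granted the named facts
  `exteriorRegion_structure` (`ExteriorRegion.lean`; Huisken–Ilmanen, J. Differential Geom. 59
  (2001), §4, Lemma 4.1 (i)) and `minimalSurface_boundary_maximumPrinciple` (`ExteriorRegion.lean`;
  Andersson–Galloway–Howard 1998, Thm. 3.10 / Eschenburg 1989, Thm. 1), an outermost minimal
  surface `S` with smooth unit normal whose exterior `V = S.exterior` is the connected exterior
  region of the end and is free of closed minimal surfaces is outermost **in the printed sense**
  of Huisken–Ilmanen's condition (iii) / Bray's Def. 5: every image of a compact immersed minimal
  surface contained in `closure V` lies in `S`. (By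
  `OutermostMOTS.exterior_eq_of_isMinimalSurfaceFree` of `OutermostHorizonSmooth.lean` — maximum
  principle, fill lemma, `IsMinimalSurfaceFree` — the exterior component `U = V ∖ K(V)` of
  Lemma 4.1 is all of `V` with `∂U = S`, and a minimal image in `closure U` lies in `K₁(V) ⊆ K(V)`,
  hence in `∂U`: `subset_frontier_of_isMinimalSurfaceImage`.)
* `riemannian_penrose_rigidity_outermost_of_penrose_rigidity_exteriorRegion`,
  `riemannian_penrose_rigidity_outermost_of_capacity_rigidity'` — **the case of equality with the
  outermost hypothesis in printed form** (every image of a compact immersed minimal surface in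
  `closure S.exterior` lies in `S`, in place of `IsMinimalSurfaceFree D.h S.exterior`; all other
  hypotheses and the conclusion those of `riemannian_penrose_rigidity_smooth` verbatim), stated at
  the level of `OutermostMOTS` with the conclusion written out in full, and proved from
  `Bray2001_penrose_rigidity_exteriorRegion` alone (Bray 2001, Thm. 19, case of equality, for
  exterior regions), resp. from the three facts of Bray's own §13 line
  (`Bray2001_capacity_eq_of_penrose_eq`, `Bray2001_oneSided_of_penrose_eq`,
  `Bray2001_capacity_rigidity`), **without** `exteriorRegion_structure`: under these hypotheses
  `V = S.exterior` is itself an exterior region with minimal boundary `S` and no other compact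
  immersed minimal surface in its closure (section "The printed-outermost form of the case of
  equality" below). This printed-outermost form is the statement of the retired named fact
  `riemannian_penrose_rigidity_outermost` (review of the decomposition of gr.S09, 2026-08-15,
  D-0026: that statement is the case of equality itself in a second encoding, three lines away
  from `Bray2001_penrose_rigidity_exteriorRegion`, not an intermediate result of its proof, so it
  is carried by these conditional theorems and not by a named fact of its own).
* `riemannian_penrose_inequality_smooth_of_outermost` — the printed-outermost variant
  `riemannian_penrose_inequality_outermost` (`OutermostHorizon.lean`) implies the corrected
  inequality `riemannian_penrose_inequality_smooth`, granted the two facts of the first item (a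
  second proof of `riemannian_penrose_inequality_smooth_of_exteriorRegion`, routed through
  `riemannian_penrose_inequality_outermost`).
* `riemannian_penrose_rigidity_smooth_of_exteriorRegion` —
  `exteriorRegion_structure → Bray2001_penrose_rigidity_exteriorRegion →
  minimalSurface_boundary_maximumPrinciple → riemannian_penrose_rigidity_smooth`: the
  printed-outermost property of the first item fed into
  `riemannian_penrose_rigidity_outermost_of_penrose_rigidity_exteriorRegion` — the corrected
  rigidity statement machine-checked down to Lemma 4.1 (i), the case of equality of Bray's Thm. 19
  for exterior regions, and the boundary maximum principle;
* `riemannian_penrose_rigidity_smooth_of_barrierPrinciple`,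
  `riemannian_penrose_rigidity_smooth_of_graph` — the same with the maximum principle discharged
  from the barrier principle `minimalSurface_barrierPrinciple` (`MinimalSurfaceBarrier.lean`),
  resp. from `minimalGraph_strongMaximumPrinciple` and `touchingSurface_locallyGraph`
  (`MinimalGraphMaximumPrinciple.lean`);
* `riemannian_penrose_rigidity_smooth_of_capacity_rigidity` — the printed-outermost property fed
  instead into `riemannian_penrose_rigidity_outermost_of_capacity_rigidity'`, i.e. Bray's own §13
  argument: `exteriorRegion_structure → Bray2001_capacity_eq_of_penrose_eq →
  Bray2001_oneSided_of_penrose_eq → Bray2001_capacity_rigidity →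
  minimalSurface_boundary_maximumPrinciple → riemannian_penrose_rigidity_smooth`.
* `riemannian_penrose_rigidity_smooth_of_graphMaximumPrinciple`,
  `riemannian_penrose_rigidity_smooth_of_capacity_rigidity_graph` — the two lines of reduction of
  the corrected statement with the local graph representation `touchingSurface_locallyGraph`
  supplied by its proof `touchingSurface_locallyGraph_holds`
  (`MinimalGraphMaximumPrincipleProofs.lean`), so that the maximum-principle input is the
  geometric maximum principle for minimal graphs `minimalGraph_strongMaximumPrinciple`
  (Andersson–Galloway–Howard 1998, Thm. 3.10, `H₀ = 0`) alone: the named facts below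
  `riemannian_penrose_rigidity_smooth` are thereby exactly `exteriorRegion_structure`,
  `Bray2001_penrose_rigidity_exteriorRegion` (resp. the three facts of Bray's §13 line) and
  `minimalGraph_strongMaximumPrinciple` (section "The corrected statement on the three remaining
  named facts" below).

* `OutermostMOTS.isMinimalSurfaceImage_subset_range_of_isMinimalSurfaceFree'`,
  `riemannian_penrose_inequality_smooth_of_outermost'`,
  `riemannian_penrose_rigidity_smooth_of_penrose_rigidity_exteriorRegion`,
  `riemannian_penrose_rigidity_smooth_of_capacity_rigidity'` — the same reductions with the
  maximum principle **discharged** (`minimalGraph_strongMaximumPrinciple_holds`,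
  `minimalSurface_boundary_maximumPrinciple_holds` of `MinimalGraphOperatorHolds.lean`:
  Andersson–Galloway–Howard 1998, Thm. 3.10, proved there through Fontenele–Silva's minimal-graph
  operator and Alexandrov's maximum principle): the named facts below
  `riemannian_penrose_rigidity_smooth` are thereby exactly `exteriorRegion_structure` and
  `Bray2001_penrose_rigidity_exteriorRegion` (resp. the three facts of Bray's §13 line), and the
  passage from the printed-outermost forms to the corrected statements rests on Lemma 4.1 (i)
  alone (section "The corrected statement on the two remaining named facts" below).

* **Caveat (2026-08-15)** — `exteriorRegion_structure` has since been **refuted as stated**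
  (one-sided components of `∂K`: the `ℝP³` geon; see the last section of this file), so all of
  the above reductions through `h1` are vacuous implications; the last section records the
  counterexample, what survives, and **proves** the purely topological step of the corrected
  reduction (`eq_empty_of_isPreconnected_of_inter_union_isPreconnected`,
  `subset_closure_of_isPreconnected_of_diff_frontier_isPreconnected`: compact one-sided surfaces
  do not separate a connected open set).

The source (read from arXiv:math/9911173, same numbering as the journal): Thm. 1 (§2) and Thm. 19
(§13) state `m ≥ √(A/16π)` "with equality if and only if `(M³, g)` is isometric to a
Schwarzschild manifold outside their respective outermost horizons", the Schwarzschild manifold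
being `(ℝ³ ∖ {0}, (1 + m/2r)⁴ δ)` with the single minimal sphere `r = m/2` ((12)); the case of
equality is proved in §13 (paragraph after Thm. 18) from (226), the derivative formula of §7 and
the case of equality of Thm. 9. Nothing of that proof is formalised here: what remains named
below `riemannian_penrose_rigidity_smooth` after this file is exactly Lemma 4.1 (i) and the case
of equality of Bray's Thm. 19 for exterior regions (`Bray2001_penrose_rigidity_exteriorRegion`) —
or, on the second line, Bray's §13 step, the one-sidedness bookkeeping and the case of equality
of Thm. 9 (the maximum principle for minimal surfaces, a third input of the earlier sections, is
discharged in the last one); below the printed-outermost form it is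
`Bray2001_penrose_rigidity_exteriorRegion` alone (resp. the three §13-line facts). In particular
the discharge `riemannian_penrose_rigidity_smooth_holds` is **not** in this file: it waits for
those facts. No definitions and no named facts are introduced.

## References

* H. L. Bray, *Proof of the Riemannian Penrose inequality using the positive mass theorem*,
  J. Differential Geom. 59 (2001) 177–267 (arXiv:math/9911173): §2, Defs. 4–5, (12) and Thm. 1
  (p. 185); §6, Thm. 9; §13, Thm. 19 (p. 240), the remark preceding it, and the proof of the case
  of equality.
* G. Huisken, T. Ilmanen, *The inverse mean curvature flow and the Riemannian Penrose
  inequality*, J. Differential Geom. 59 (2001) 353–437: §0 condition (iii); §4, Lemma 4.1 (i)–(ii)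
  and its proof.
* L. Andersson, G. J. Galloway, R. Howard, Comm. Pure Appl. Math. 51 (1998) 581–624, Thm. 3.10.
* K. L. Baker, G. J. Galloway, *On the topology of initial data sets with higher genus ends*,
  Comm. Math. Phys. 336 (2015) 431–440 (arXiv:1403.0988), §3 (the `ℝP³` geon and its one-sided
  minimal projective plane).
-/

noncomputable section

open Bundle Set Manifold TopologicalSpace Filter MeasureTheory Asymptotics
open scoped ContDiff Topology ENNReal Manifold Real

namespace Literature.Geometry.Lorentzian

open PseudoRiemannianMetric


/-! ### An outermost horizon with smooth normal is outermost in the printed sense -/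

section Outermost

variable {X : Type} [TopologicalSpace X] [ChartedSpace E3 X] [IsManifold (𝓡 3) ∞ X]
  [T2Space X] [SecondCountableTopology X] [ConnectedSpace X]

/-- **An outermost horizon with smooth normal is outermost in the printed sense** (Huisken–
Ilmanen, J. Differential Geom. 59 (2001), §4, Lemma 4.1 (i), read for an outermost horizon;
Bray, J. Differential Geom. 59 (2001), §2, Def. 5). Let `S` be an outermost minimal surface of
the time-symmetric data `(X, h, 0)` on the complete manifold `X` with *smooth* unit normal, whose
exterior `V = S.exterior` is the connected exterior region of the asymptotically flat end `e`
(`IsExteriorRegion`, `IsMetricAsymptoticallyFlat e D 1`) and contains no closed minimal surface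
(`IsMinimalSurfaceFree`). Granted the named facts `exteriorRegion_structure` (Lemma 4.1 (i):
the exterior component `U = V ∖ K(V)` of the end, bounded by compact embedded minimal surfaces)
and `minimalSurface_boundary_maximumPrinciple` (the boundary maximum principle for minimal
surfaces), every image `N` of a compact immersed minimal surface with smooth unit normal
contained in `closure V` lies in `S`: by `OutermostMOTS.exterior_eq_of_isMinimalSurfaceFree`
(`OutermostHorizonSmooth.lean`) `U = V` and `∂U = S`, and `N ⊆ closure U` lies in
`K₁(V) ⊆ K(V)`, hence in `∂U` (`subset_frontier_of_isMinimalSurfaceImage`). This is the printed outermost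
hypothesis of `riemannian_penrose_inequality_outermost` (`OutermostHorizon.lean`) and of
`riemannian_penrose_rigidity_outermost_of_penrose_rigidity_exteriorRegion` below.
[cite: HuiskenIlmanenIMCF2001, §4, Lemma 4.1 (i) and its proof] -/
theorem OutermostMOTS.isMinimalSurfaceImage_subset_range_of_isMinimalSurfaceFree
    (h1 : exteriorRegion_structure) (h5 : minimalSurface_boundary_maximumPrinciple)
    {D : InitialDataSet (𝓡 3) X} [D.metric.HasLeviCivita] {e : AFEnd X}
    (S : OutermostMOTS (𝓡 3) D.h 0)
    (hν : ContMDiff (𝓡 2) (𝓡 3).tangent ∞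
      (fun y ↦ (TotalSpace.mk' E3 (S.f y) (S.ν y) : TangentBundle (𝓡 3) X)))
    (hcomp : D.IsComplete) (hAF : e.IsMetricAsymptoticallyFlat D 1)
    (hfree : IsMinimalSurfaceFree D.h S.exterior) (hext : IsExteriorRegion e S.exterior)
    {N : Set X} (hN : IsMinimalSurfaceImage D.h N) (hNV : N ⊆ closure (S.exterior : Set X)) :
    N ⊆ range S.f := by
  -- the exterior component `U = V ∖ K(V)` of the end, with its minimal boundary `B`
  obtain ⟨-, U, B, hUV, hUext, -⟩ := h1 X D e S.exterior (S.toMinimalBoundary hν) hcomp hext hAF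
  have hUV' : (U : Set X) ⊆ (S.exterior : Set X) := hUV ▸ sdiff_subset
  -- `U = V` and `∂U = S` (maximum principle + fill lemma + `IsMinimalSurfaceFree`)
  obtain ⟨hUS, hBS⟩ := S.exterior_eq_of_isMinimalSurfaceFree h5 hν hfree hext.isConnected B hUV'
    hUext.nonempty
  -- a minimal image in `closure U = closure V` lies in `K(V)`, hence in `∂U = S`
  rw [← hBS, ← B.frontier_eq]
  refine subset_frontier_of_isMinimalSurfaceImage U.isOpen hUV hN ?_
  rw [hUS]
  exact hNV

end Outermost

/-! ### The printed-outermost form of the case of equality, without Huisken–Ilmanen's Lemma 4.1 (i)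

The two theorems of this section state the case of equality of the Riemannian Penrose
inequality at the level of `OutermostMOTS` with the outermost hypothesis **in printed form** —
Huisken–Ilmanen's condition (iii) of §0 / Bray's Def. 5: every image of a compact immersed
minimal surface with smooth unit normal (`IsMinimalSurfaceImage`) contained in
`closure S.exterior` lies in `S` — in place of `IsMinimalSurfaceFree D.h S.exterior`, all other
hypotheses and the conclusion being those of `riemannian_penrose_rigidity_smooth`
(`PenroseRigidity.lean`) verbatim: `k = 0`; `R(h) ≥ 0` on `X`; asymptotic flatness of order `1`
on `e` and Bray's curvature decay `scalarCurvatureCoeff e D = O(‖x‖^{-q})` for some `q > 3`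
(Def. 21); completeness of `X`; existence of the ADM energy limit (`m = E = e.admEnergy D`,
(225)); a *nonempty* outermost minimal surface `S : OutermostMOTS (𝓡 3) D.h 0` (possibly
disconnected) whose unit normal `S.ν` is smooth as a map into `TX` and whose exterior
`S.exterior` is the connected exterior region of the end `e`, compact modulo the end
(`IsExteriorRegion`); equality `√(|S|/16π) = E`, `|S| = S.surfaceArea`; conclusion: a
diffeomorphism `Φ` of `S.exterior` onto `exteriorRegion (E/2) = {E/2 < ‖y‖} ⊆ E3` with
`Φ^* ((1 + E/(2‖y‖))⁴ δ) = h` there (Bray, J. Differential Geom. 59 (2001), Thm. 19 (p. 240) and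
Thm. 1 (p. 185), case of equality, with (12); only this direction). The conclusion is written
out in full: it is the statement of `riemannian_penrose_rigidity_outermost` of
`PenroseRigidity.lean` unfolded, so that this form of the case of equality rests on the two
conditional theorems below and not on a named fact of its own (review of the decomposition of
gr.S09, 2026-08-15, D-0026: that statement is the case of equality itself in a second encoding,
not an intermediate result of its proof, and the named fact is retired in favour of these
theorems).

Under these hypotheses the open set `V = S.exterior` is *itself* an exterior region of the end
`e` in the sense of the exterior-region facts: it is connected and compact modulo the end
(`IsExteriorRegion e S.exterior` is a hypothesis), its topological boundary is the compact
minimal surface `S` with smooth unit normal pointing into it (`OutermostMOTS.toMinimalBoundary`,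
from the hypothesis that `S.ν` is smooth; its boundary map is `S.f` by `rfl`), and the printed
outermost hypothesis is verbatim the hypothesis "no other compact minimal surfaces (even
immersed)" of those facts for `U := S.exterior`. Hence the case of equality of Bray's Thm. 19
for exterior regions, resp. the §13 facts with the case of equality of Thm. 9, apply to
`U := S.exterior` and `Σ₀ := S` directly, and no passage through the exterior component
`U = V ∖ K(V)` of Lemma 4.1 (i) (`exteriorRegion_structure`) is needed. This is Bray's remark
preceding Thm. 19 (§13: *"none of the arguments in this paper have used anything about the
original manifold inside the original horizon `Σ₀`"*) read in the open-set encoding: only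
`S.exterior` and its boundary enter. (For the corrected statement
`riemannian_penrose_rigidity_smooth` Lemma 4.1 (i) remains in use, through
`OutermostMOTS.isMinimalSurfaceImage_subset_range_of_isMinimalSurfaceFree`.) -/

/-- **gr.S09, rigidity, outermost hypothesis in printed form: from Bray's Theorem 19 (case of
equality) alone, proved.** The named fact `Bray2001_penrose_rigidity_exteriorRegion` (Bray,
J. Differential Geom. 59 (2001), Thm. 19 (p. 240), case of equality, in the exterior-region
encoding, with Huisken–Ilmanen's Lemma 4.1 (ii) making the boundary outer-minimizing) implies
the case of equality for an outermost minimal surface `S` of complete time-symmetric data with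
smooth unit normal which is outermost in the printed sense (every image of a compact immersed
minimal surface in `closure S.exterior` lies in `S`; hypotheses listed in the section docstring,
the statement of `riemannian_penrose_rigidity_outermost` of `PenroseRigidity.lean` written out):
if `√(|S|/16π) = E`, then `S.exterior` is isometric to the Schwarzschild exterior
`({E/2 < ‖y‖}, (1 + E/(2‖y‖))⁴ δ)` of mass `E = e.admEnergy D`. Proof: the fact is applied to
the exterior region `U := S.exterior` of `e` (`IsExteriorRegion`, a hypothesis) with minimal
boundary `S.toMinimalBoundary hν` — whose hypothesis "no other compact immersed minimal surface
in `closure U`" is the printed outermost hypothesis — and to the nonempty compact surface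
`S.surf` embedded into `∂U = range S.f` by `S.f` itself (`S.surfaceArea = totalArea (S.f^* h)` by
definition); `exteriorRegion_structure` is not used.
[cite: BrayRPI2001, Thm. 19 (p. 240) and Thm. 1 (p. 185) equality case with (12), Def. 21, (225), and the remark preceding Thm. 19 (§13)]
[cite: HuiskenIlmanenIMCF2001, §4, Lemma 4.1 (ii)] -/
theorem riemannian_penrose_rigidity_outermost_of_penrose_rigidity_exteriorRegion
    (h2 : Bray2001_penrose_rigidity_exteriorRegion) :
    ∀ (X : Type) [TopologicalSpace X] [ChartedSpace E3 X] [IsManifold (𝓡 3) ∞ X] [T2Space X]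
      [SecondCountableTopology X] [ConnectedSpace X]
      (D : InitialDataSet (𝓡 3) X) [D.metric.HasLeviCivita] (e : AFEnd X)
      (S : OutermostMOTS (𝓡 3) D.h 0),
      ContMDiff (𝓡 2) (𝓡 3).tangent ∞
        (fun y ↦ (TotalSpace.mk' E3 (S.f y) (S.ν y) : TangentBundle (𝓡 3) X)) →
      D.IsTimeSymmetric → (∀ x : X, 0 ≤ D.metric.scalarCurvature x) →
      e.IsAsymptoticallyFlat D 1 →
      (∃ q : ℝ, 3 < q ∧
        (fun x ↦ e.scalarCurvatureCoeff D x) =O[Bornology.cobounded E3] fun x ↦ ‖x‖ ^ (-q)) →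
      D.IsComplete → (∃ m, e.HasADMEnergy D m) → Nonempty S.surf →
      (∀ N, IsMinimalSurfaceImage D.h N → N ⊆ closure (S.exterior : Set X) → N ⊆ range S.f) →
      IsExteriorRegion e S.exterior →
      Real.sqrt (S.surfaceArea.toReal / (16 * π)) = e.admEnergy D →
      ∃ Φ : Diffeomorph (𝓡 3) (𝓡 3) S.exterior (exteriorRegion (e.admEnergy D / 2)) ∞,
        ∀ x : S.exterior, pullbackBilin (I := 𝓡 3) (I' := 𝓡 3) Φ
          (fun y ↦ (1 + e.admEnergy D / (2 * ‖(y : E3)‖)) ^ 4 •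
            (innerSL ℝ (E := E3) : E3 →L[ℝ] E3 →L[ℝ] ℝ)) x = D.metric.val x.1 := by
  intro X _ _ _ _ _ _ D _ e S hν _hts hR hAF hRq hcomp hADM hne hout hext heq
  -- Thm. 19, case of equality, for the exterior region `S.exterior` with minimal boundary `S`,
  -- applied to `S` embedded into its own image
  exact h2 X D e S.exterior (S.toMinimalBoundary hν) hcomp hext hAF.isMetricAsymptoticallyFlat
    hRq hADM (fun x _ ↦ hR x) hout S.surf S.f S.hpb S.isSpacelikeImmersion S.isEmbedding
    subset_rfl hne heq

/-- **gr.S09, rigidity, outermost hypothesis in printed form: Bray's §13 argument assembled on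
`S.exterior` itself, proved.** The named facts `Bray2001_capacity_eq_of_penrose_eq` (Bray,
J. Differential Geom. 59 (2001), §13: equality in the Penrose inequality forces
`ℰ(∂M', g) = 2m`), `Bray2001_oneSided_of_penrose_eq` (Thm. 19 bookkeeping: in the case of
equality no boundary component is doubled) and `Bray2001_capacity_rigidity` (`MassCapacity.lean`:
Thm. 9 (§6), case of equality — `m = ½ ℰ(Σ, g)` forces the outside of `Σ` to be the
Schwarzschild exterior) imply the same printed-outermost form of the case of equality (the
statement of `riemannian_penrose_rigidity_outermost_of_penrose_rigidity_exteriorRegion`), again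
without `exteriorRegion_structure`: with `U := S.exterior` and `B := S.toMinimalBoundary hν`
(boundary map `S.f`, normal `S.ν`), the two §13 facts — whose exterior-region hypothesis is the
printed outermost hypothesis — give `ℰ(∂U)/2 = E` and one-sidedness of `U` along
`∂U = range S.f`, so that `U` is the outside of the horizon `S ∈ 𝒮` towards `e`
(`IsOutsideOf e S.exterior S.f S.ν`, with `S.frontier_exterior`, `S.pointsInto` and
`IsExteriorRegion e S.exterior`); Thm. 9, case of equality (with the Borel structure `borel X`
and local compactness of the manifold `X`, `Manifold.locallyCompact_of_finiteDimensional`, to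
form the capacity), applied to the horizon `S` — `H = 0` from `θ⁺ = 0` and `k = 0`,
`(S.toMinimalBoundary hν).isMinimal` — gives the isometry of `S.exterior` with the Schwarzschild
exterior of mass `E`. This is the last paragraph of Bray's proof of the case of equality (§13:
"`ℰ(Σ⁺(0), g₀) = 2 m(0)` … by the case of equality of Theorem 9, `(M³, g)` is a Schwarzschild
manifold outside `Σ⁺(0)`. Hence, `Σ⁺(0)` is the outermost horizon"), machine-checked on top of
the named facts.
[cite: BrayRPI2001, §13, proof of the case of equality (after Thm. 18), and Thm. 9 (§6)] -/
theorem riemannian_penrose_rigidity_outermost_of_capacity_rigidity'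
    (h13 : Bray2001_capacity_eq_of_penrose_eq) (h13' : Bray2001_oneSided_of_penrose_eq)
    (h9 : Bray2001_capacity_rigidity) :
    ∀ (X : Type) [TopologicalSpace X] [ChartedSpace E3 X] [IsManifold (𝓡 3) ∞ X] [T2Space X]
      [SecondCountableTopology X] [ConnectedSpace X]
      (D : InitialDataSet (𝓡 3) X) [D.metric.HasLeviCivita] (e : AFEnd X)
      (S : OutermostMOTS (𝓡 3) D.h 0),
      ContMDiff (𝓡 2) (𝓡 3).tangent ∞
        (fun y ↦ (TotalSpace.mk' E3 (S.f y) (S.ν y) : TangentBundle (𝓡 3) X)) →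
      D.IsTimeSymmetric → (∀ x : X, 0 ≤ D.metric.scalarCurvature x) →
      e.IsAsymptoticallyFlat D 1 →
      (∃ q : ℝ, 3 < q ∧
        (fun x ↦ e.scalarCurvatureCoeff D x) =O[Bornology.cobounded E3] fun x ↦ ‖x‖ ^ (-q)) →
      D.IsComplete → (∃ m, e.HasADMEnergy D m) → Nonempty S.surf →
      (∀ N, IsMinimalSurfaceImage D.h N → N ⊆ closure (S.exterior : Set X) → N ⊆ range S.f) →
      IsExteriorRegion e S.exterior →
      Real.sqrt (S.surfaceArea.toReal / (16 * π)) = e.admEnergy D →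
      ∃ Φ : Diffeomorph (𝓡 3) (𝓡 3) S.exterior (exteriorRegion (e.admEnergy D / 2)) ∞,
        ∀ x : S.exterior, pullbackBilin (I := 𝓡 3) (I' := 𝓡 3) Φ
          (fun y ↦ (1 + e.admEnergy D / (2 * ‖(y : E3)‖)) ^ 4 •
            (innerSL ℝ (E := E3) : E3 →L[ℝ] E3 →L[ℝ] ℝ)) x = D.metric.val x.1 := by
  intro X _ _ _ _ _ _ D _ e S hν hts hR hAF hRq hcomp hADM hne hout hext heq
  -- the Borel structure and local compactness of `X`, to form the capacity
  letI : MeasurableSpace X := borel X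
  haveI : BorelSpace X := ⟨rfl⟩
  haveI : LocallyCompactSpace X := Manifold.locallyCompact_of_finiteDimensional (M := X) (𝓡 3)
  -- §13 for the exterior region `S.exterior` with minimal boundary `S`: `ℰ(S)/2 = E`, and
  -- `S.exterior` lies on one side of `S`
  have hcap := h13 X D e S.exterior (S.toMinimalBoundary hν) hcomp hext
    hAF.isMetricAsymptoticallyFlat hRq hADM (fun x _ ↦ hR x) hout S.surf S.f S.hpb
    S.isSpacelikeImmersion S.isEmbedding subset_rfl hne heq
  have hside := h13' X D e S.exterior (S.toMinimalBoundary hν) hcomp hext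
    hAF.isMetricAsymptoticallyFlat hRq hADM (fun x _ ↦ hR x) hout S.surf S.f S.hpb
    S.isSpacelikeImmersion S.isEmbedding subset_rfl hne heq
  -- `S.exterior` is the outside of the horizon `S ∈ 𝒮` towards `e`
  have hout' : IsOutsideOf e S.exterior S.f S.ν := ⟨S.frontier_exterior, S.pointsInto, hside, hext⟩
  -- Thm. 9, case of equality, for the horizon `S`
  exact h9 X D e S.exterior S.surf S.f S.ν S.hpb S.isSpacelikeImmersion hts hR hAF hRq hcomp hADM
    S.isEmbedding S.isUnitNormal (S.toMinimalBoundary hν).isMinimal hout' hne hcap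

/-! ### The corrected inequality from its printed-outermost variant -/

/-- **gr.S09, general horizon: the corrected inequality from the printed-outermost variant**
(a second proof of `riemannian_penrose_inequality_smooth_of_exteriorRegion` of
`OutermostHorizonSmooth.lean`, routed through `riemannian_penrose_inequality_outermost` of
`OutermostHorizon.lean`). Granted `exteriorRegion_structure` and
`minimalSurface_boundary_maximumPrinciple`, `riemannian_penrose_inequality_outermost` implies
`riemannian_penrose_inequality_smooth`: the horizon is outermost in the printed sense by
`OutermostMOTS.isMinimalSurfaceImage_subset_range_of_isMinimalSurfaceFree`.
[cite: BrayRPI2001, Thm. 19 (p. 240)] [cite: HuiskenIlmanenIMCF2001, §4, Lemma 4.1 (i)] -/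
theorem riemannian_penrose_inequality_smooth_of_outermost (h1 : exteriorRegion_structure)
    (h5 : minimalSurface_boundary_maximumPrinciple) (h : riemannian_penrose_inequality_outermost) :
    riemannian_penrose_inequality_smooth := by
  intro X _ _ _ _ _ _ D _ e S hν hts hR hAF hRq hcomp hADM hfree hext
  exact h X D e S hν hts hR hAF hRq hcomp hADM
    (fun N hN hNV ↦ S.isMinimalSurfaceImage_subset_range_of_isMinimalSurfaceFree h1 h5 hν hcomp
      hAF.isMetricAsymptoticallyFlat hfree hext hN hNV) hext

/-! ### Reduction of the corrected rigidity statement to Bray's Theorem 19, case of equality -/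

/-- **gr.S09, rigidity (corrected statement): the reduction to Bray's Theorem 19, case of
equality, proved.** The named facts `exteriorRegion_structure` (Huisken–Ilmanen 2001,
Lemma 4.1 (i), `ExteriorRegion.lean`), `Bray2001_penrose_rigidity_exteriorRegion` (Bray 2001,
Thm. 19, case of equality, with Huisken–Ilmanen's Lemma 4.1 (ii), `PenroseRigidity.lean`) and
`minimalSurface_boundary_maximumPrinciple` (the strong maximum principle for minimal surfaces,
boundary form, `ExteriorRegion.lean`) imply `riemannian_penrose_rigidity_smooth`, the corrected
form of `riemannian_penrose_rigidity` (`MassInequalities.lean`): the printed-outermost property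
`OutermostMOTS.isMinimalSurfaceImage_subset_range_of_isMinimalSurfaceFree` fed into
`riemannian_penrose_rigidity_outermost_of_penrose_rigidity_exteriorRegion`. Unfolded:
`V = S.exterior` has minimal boundary `S`; Lemma 4.1 gives the exterior component `U = V ∖ K(V)`,
an exterior region with compact minimal boundary and no other compact minimal surface in
`closure U`; the maximum principle with `IsMinimalSurfaceFree` gives `U = V`, `∂U = S`, so every
compact immersed minimal surface in `closure V` lies in `S`; and the case of equality of Thm. 19
for the exterior region `V`, applied to the nonempty surface `S` embedded into `∂V` with
`√(|S|/16π) = E`, is the isometry of `S.exterior` with the Schwarzschild exterior of mass `E`.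
[cite: BrayRPI2001, Thm. 19 (p. 240) equality case and §13 (proof of the case of equality)]
[cite: HuiskenIlmanenIMCF2001, §4, Lemma 4.1] -/
theorem riemannian_penrose_rigidity_smooth_of_exteriorRegion (h1 : exteriorRegion_structure)
    (h2 : Bray2001_penrose_rigidity_exteriorRegion)
    (h5 : minimalSurface_boundary_maximumPrinciple) : riemannian_penrose_rigidity_smooth := by
  intro X _ _ _ _ _ _ D _ e S hν hts hR hAF hRq hcomp hADM hne hfree hext heq
  exact riemannian_penrose_rigidity_outermost_of_penrose_rigidity_exteriorRegion h2 X D e S hν hts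
    hR hAF hRq hcomp hADM hne
    (fun N hN hNV ↦ S.isMinimalSurfaceImage_subset_range_of_isMinimalSurfaceFree h1 h5 hν hcomp
      hAF.isMetricAsymptoticallyFlat hfree hext hN hNV) hext heq

/-- **gr.S09, rigidity (corrected statement), with the maximum principle discharged from the
barrier principle**: `exteriorRegion_structure → Bray2001_penrose_rigidity_exteriorRegion →
minimalSurface_barrierPrinciple → riemannian_penrose_rigidity_smooth`
(`riemannian_penrose_rigidity_smooth_of_exteriorRegion` with
`minimalSurface_boundary_maximumPrinciple_of_barrierPrinciple` of `MinimalSurfaceBarrier.lean`).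
The remaining named facts are Huisken–Ilmanen's Lemma 4.1 (i), the case of equality of Bray's
Thm. 19 for exterior regions (with Lemma 4.1 (ii)), and the local barrier (tangency) principle
for minimal surfaces. [cite: BrayRPI2001, Thm. 19 (p. 240) equality case]
[cite: HuiskenIlmanenIMCF2001, §4, Lemma 4.1] -/
theorem riemannian_penrose_rigidity_smooth_of_barrierPrinciple (h1 : exteriorRegion_structure)
    (h2 : Bray2001_penrose_rigidity_exteriorRegion) (hbar : minimalSurface_barrierPrinciple) :
    riemannian_penrose_rigidity_smooth :=
  riemannian_penrose_rigidity_smooth_of_exteriorRegion h1 h2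
    (minimalSurface_boundary_maximumPrinciple_of_barrierPrinciple hbar)

/-- **gr.S09, rigidity (corrected statement)**, with the maximum principle reduced to the two
facts of `MinimalGraphMaximumPrinciple.lean`: `exteriorRegion_structure →
Bray2001_penrose_rigidity_exteriorRegion → minimalGraph_strongMaximumPrinciple →
touchingSurface_locallyGraph → riemannian_penrose_rigidity_smooth`
(`riemannian_penrose_rigidity_smooth_of_barrierPrinciple` with
`minimalSurface_barrierPrinciple_of_graph`; the geometric maximum principle for minimal graphs is
Andersson–Galloway–Howard 1998, Thm. 3.10). [cite: BrayRPI2001, Thm. 19 (p. 240) equality case]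
[cite: AnderssonGallowayHoward1998, Thm. 3.10] -/
theorem riemannian_penrose_rigidity_smooth_of_graph (h1 : exteriorRegion_structure)
    (h2 : Bray2001_penrose_rigidity_exteriorRegion) (hmax : minimalGraph_strongMaximumPrinciple)
    (hgraph : touchingSurface_locallyGraph) : riemannian_penrose_rigidity_smooth :=
  riemannian_penrose_rigidity_smooth_of_barrierPrinciple h1 h2
    (minimalSurface_barrierPrinciple_of_graph hmax hgraph)

/-! ### Reduction of the corrected rigidity statement along Bray's §13 argument -/

/-- **gr.S09, rigidity (corrected statement): Bray's §13 argument, assembled.** The named facts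
`exteriorRegion_structure` (Huisken–Ilmanen 2001, Lemma 4.1 (i)),
`Bray2001_capacity_eq_of_penrose_eq` (Bray 2001, §13: equality in the Penrose inequality forces
`ℰ(∂M', g) = 2m`), `Bray2001_oneSided_of_penrose_eq` (Thm. 19 bookkeeping: no boundary
component is doubled), `Bray2001_capacity_rigidity` (`MassCapacity.lean`: Bray 2001, Thm. 9, case
of equality — `m = ½ ℰ(Σ, g)` forces the outside of `Σ` to be the Schwarzschild exterior) and
`minimalSurface_boundary_maximumPrinciple` imply `riemannian_penrose_rigidity_smooth`: the
printed-outermost property `OutermostMOTS.isMinimalSurfaceImage_subset_range_of_isMinimalSurfaceFree`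
fed into `riemannian_penrose_rigidity_outermost_of_capacity_rigidity'`. This is the last
paragraph of Bray's proof of the case of equality (§13: "`ℰ(Σ⁺(0), g₀) = 2 m(0)` … by the case
of equality of Theorem 9, `(M³, g)` is a Schwarzschild manifold outside `Σ⁺(0)`"),
machine-checked on top of the named facts for the corrected statement with the outermost
hypothesis in the form `IsMinimalSurfaceFree`.
[cite: BrayRPI2001, §13, proof of the case of equality, and Thm. 9 (§6)]
[cite: HuiskenIlmanenIMCF2001, §4, Lemma 4.1] -/
theorem riemannian_penrose_rigidity_smooth_of_capacity_rigidity (h1 : exteriorRegion_structure)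
    (h13 : Bray2001_capacity_eq_of_penrose_eq) (h13' : Bray2001_oneSided_of_penrose_eq)
    (h9 : Bray2001_capacity_rigidity) (h5 : minimalSurface_boundary_maximumPrinciple) :
    riemannian_penrose_rigidity_smooth := by
  intro X _ _ _ _ _ _ D _ e S hν hts hR hAF hRq hcomp hADM hne hfree hext heq
  exact riemannian_penrose_rigidity_outermost_of_capacity_rigidity' h13 h13' h9 X D e S hν hts hR
    hAF hRq hcomp hADM hne
    (fun N hN hNV ↦ S.isMinimalSurfaceImage_subset_range_of_isMinimalSurfaceFree h1 h5 hν hcomp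
      hAF.isMetricAsymptoticallyFlat hfree hext hN hNV) hext heq
/-! ### The corrected statement on the three remaining named facts

With the local graph representation `touchingSurface_locallyGraph` discharged
(`touchingSurface_locallyGraph_holds`, `MinimalGraphMaximumPrincipleProofs.lean`: first-derivative
test and the inverse function theorem for manifolds), the maximum-principle input of
`riemannian_penrose_rigidity_smooth_of_graph` and of
`riemannian_penrose_rigidity_smooth_of_capacity_rigidity` shrinks to the geometric maximum
principle for minimal graphs, `minimalGraph_strongMaximumPrinciple` (Andersson–Galloway–Howard
1998, Thm. 3.10 with `H₀ = 0`), alone. The two theorems below record the resulting trust base of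
the corrected case of equality `riemannian_penrose_rigidity_smooth`: on the line through Bray's
Thm. 19 it is `exteriorRegion_structure` (Huisken–Ilmanen, Lemma 4.1 (i)),
`Bray2001_penrose_rigidity_exteriorRegion` (Thm. 19, case of equality, with Lemma 4.1 (ii)) and
`minimalGraph_strongMaximumPrinciple`; on Bray's own §13 line the middle fact is replaced by
`Bray2001_capacity_eq_of_penrose_eq`, `Bray2001_oneSided_of_penrose_eq` and
`Bray2001_capacity_rigidity` (Thm. 9, case of equality). The discharge
`riemannian_penrose_rigidity_smooth_holds` is either theorem applied to the discharges of its
hypotheses, none of which is in the tree yet. -/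

/-- **gr.S09, rigidity (corrected statement), on the three remaining named facts**:
`exteriorRegion_structure → Bray2001_penrose_rigidity_exteriorRegion →
minimalGraph_strongMaximumPrinciple → riemannian_penrose_rigidity_smooth`
(`riemannian_penrose_rigidity_smooth_of_graph` with `touchingSurface_locallyGraph` supplied by
`touchingSurface_locallyGraph_holds`). Unfolded: under the hypotheses of
`riemannian_penrose_rigidity_smooth` the horizon `S` (smooth unit normal) bounds
`V = S.exterior`; Lemma 4.1 (i) gives the exterior component `U = V ∖ K(V)` bounded by embedded
minimal spheres in `closure V`; spheres inside `V` are excluded by `IsMinimalSurfaceFree`, spheres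
touching `S` coincide with components of `S` by the boundary maximum principle — here obtained
from Thm. 3.10 for minimal graphs through the slice box of `MinimalSurfaceBarrier.lean` and the
local graph representation — so `U = V`, `∂U = S`, every compact immersed minimal surface in
`closure V` lies in `S`, and the case of equality of Thm. 19 for the exterior region `V` with
`√(|S|/16π) = E` is the isometry of `S.exterior` with the Schwarzschild exterior
`({E/2 < ‖y‖}, (1 + E/(2‖y‖))⁴ δ)` of mass `E = e.admEnergy D`.
[cite: BrayRPI2001, Thm. 19 (p. 240) and Thm. 1 (p. 185), case of equality, and §13]
[cite: HuiskenIlmanenIMCF2001, §4, Lemma 4.1 (i)–(ii)]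
[cite: AnderssonGallowayHoward1998, Thm. 3.10] -/
theorem riemannian_penrose_rigidity_smooth_of_graphMaximumPrinciple
    (h1 : exteriorRegion_structure) (h2 : Bray2001_penrose_rigidity_exteriorRegion)
    (hmax : minimalGraph_strongMaximumPrinciple) : riemannian_penrose_rigidity_smooth :=
  riemannian_penrose_rigidity_smooth_of_graph h1 h2 hmax touchingSurface_locallyGraph_holds

/-- **gr.S09, rigidity (corrected statement): Bray's §13 line on the remaining named facts**:
`exteriorRegion_structure → Bray2001_capacity_eq_of_penrose_eq →
Bray2001_oneSided_of_penrose_eq → Bray2001_capacity_rigidity →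
minimalGraph_strongMaximumPrinciple → riemannian_penrose_rigidity_smooth`
(`riemannian_penrose_rigidity_smooth_of_capacity_rigidity` with the boundary maximum principle
`minimalSurface_boundary_maximumPrinciple_of_graph hmax touchingSurface_locallyGraph_holds`).
This is the last paragraph of Bray's proof of the case of equality (§13: equality in (226) for
all `t ≥ 0` forces `ℰ(Σ⁺(0), g₀) = 2 m(0)`, and the case of equality of Thm. 9 makes `(M³, g)`
a Schwarzschild manifold outside `Σ⁺(0)`), machine-checked on top of the named facts for the
corrected statement, with the maximum principle reduced to Thm. 3.10 for minimal graphs.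
[cite: BrayRPI2001, §13, proof of the case of equality (after Thm. 18), and Thm. 9 (§6)]
[cite: HuiskenIlmanenIMCF2001, §4, Lemma 4.1 (i)]
[cite: AnderssonGallowayHoward1998, Thm. 3.10] -/
theorem riemannian_penrose_rigidity_smooth_of_capacity_rigidity_graph
    (h1 : exteriorRegion_structure) (h13 : Bray2001_capacity_eq_of_penrose_eq)
    (h13' : Bray2001_oneSided_of_penrose_eq) (h9 : Bray2001_capacity_rigidity)
    (hmax : minimalGraph_strongMaximumPrinciple) : riemannian_penrose_rigidity_smooth :=
  riemannian_penrose_rigidity_smooth_of_capacity_rigidity h1 h13 h13' h9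
    (minimalSurface_boundary_maximumPrinciple_of_graph hmax touchingSurface_locallyGraph_holds)

/-! ### The corrected statement on the two remaining named facts

`MinimalGraphOperatorHolds.lean` discharges the geometric maximum principle for minimal graphs,
`minimalGraph_strongMaximumPrinciple_holds` (Andersson–Galloway–Howard, Comm. Pure Appl. Math. 51
(1998), Thm. 3.10 with `H₀ = 0`: Fontenele–Silva's minimal-graph operator of a chart, elliptic and
vanishing on minimal graphs, fed into Alexandrov's maximum principle of
`TangencyMaximumPrinciple.lean`), and with it the barrier principle and the boundary maximum
principle for minimal surfaces (`minimalSurface_barrierPrinciple_holds`,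
`minimalSurface_boundary_maximumPrinciple_holds`). Feeding these discharges into the reductions
above leaves the corrected case of equality `riemannian_penrose_rigidity_smooth` resting on
exactly **two** named facts on the line through Bray's Thm. 19 — `exteriorRegion_structure`
(Huisken–Ilmanen 2001, Lemma 4.1 (i): the exterior component `U = V ∖ K(V)` of the end, bounded by
embedded minimal spheres; geometric measure theory) and `Bray2001_penrose_rigidity_exteriorRegion`
(Bray 2001, Thm. 19, case of equality, for exterior regions: the conformal flow of metrics and the
case of equality of the positive mass theorem) — and, on Bray's own §13 line, on
`exteriorRegion_structure` together with `Bray2001_capacity_eq_of_penrose_eq`,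
`Bray2001_oneSided_of_penrose_eq` and `Bray2001_capacity_rigidity` (Thm. 9, case of equality).
The printed-outermost property of a minimal-surface-free horizon with smooth normal, and with it
the passage from the printed-outermost forms (the theorems
`riemannian_penrose_rigidity_outermost_of_penrose_rigidity_exteriorRegion` /
`riemannian_penrose_rigidity_outermost_of_capacity_rigidity'` above, and the fact
`riemannian_penrose_inequality_outermost` of `OutermostHorizon.lean`) to the corrected statements,
now rest on Lemma 4.1 (i) alone. The discharge `riemannian_penrose_rigidity_smooth_holds` is
`riemannian_penrose_rigidity_smooth_of_penrose_rigidity_exteriorRegion` (or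
`riemannian_penrose_rigidity_smooth_of_capacity_rigidity'`) applied to the discharges of its
hypotheses, none of which is in the tree yet. -/

section TwoFacts

variable {X : Type} [TopologicalSpace X] [ChartedSpace E3 X] [IsManifold (𝓡 3) ∞ X]
  [T2Space X] [SecondCountableTopology X] [ConnectedSpace X]

/-- **An outermost horizon with smooth normal is outermost in the printed sense, granted
Lemma 4.1 (i) alone** (`OutermostMOTS.isMinimalSurfaceImage_subset_range_of_isMinimalSurfaceFree`
with the boundary maximum principle for minimal surfaces supplied by its proof
`minimalSurface_boundary_maximumPrinciple_holds` of `MinimalGraphOperatorHolds.lean`): if the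
outermost minimal surface `S` of the complete time-symmetric data `(X, h, 0)` has smooth unit
normal and its exterior `V = S.exterior` is the connected exterior region of the asymptotically
flat end `e` and contains no closed minimal surface, then every image of a compact immersed
minimal surface with smooth unit normal contained in `closure V` lies in `S` (Huisken–Ilmanen's
condition (iii) of §0 / Bray's Def. 5 for `S`).
[cite: HuiskenIlmanenIMCF2001, §4, Lemma 4.1 (i) and its proof]
[cite: AnderssonGallowayHoward1998, Thm. 3.10] -/
theorem OutermostMOTS.isMinimalSurfaceImage_subset_range_of_isMinimalSurfaceFree'
    (h1 : exteriorRegion_structure)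
    {D : InitialDataSet (𝓡 3) X} [D.metric.HasLeviCivita] {e : AFEnd X}
    (S : OutermostMOTS (𝓡 3) D.h 0)
    (hν : ContMDiff (𝓡 2) (𝓡 3).tangent ∞
      (fun y ↦ (TotalSpace.mk' E3 (S.f y) (S.ν y) : TangentBundle (𝓡 3) X)))
    (hcomp : D.IsComplete) (hAF : e.IsMetricAsymptoticallyFlat D 1)
    (hfree : IsMinimalSurfaceFree D.h S.exterior) (hext : IsExteriorRegion e S.exterior)
    {N : Set X} (hN : IsMinimalSurfaceImage D.h N) (hNV : N ⊆ closure (S.exterior : Set X)) :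
    N ⊆ range S.f :=
  S.isMinimalSurfaceImage_subset_range_of_isMinimalSurfaceFree h1
    minimalSurface_boundary_maximumPrinciple_holds hν hcomp hAF hfree hext hN hNV

end TwoFacts

/-- **gr.S09, general horizon: the corrected inequality from the printed-outermost variant,
granted Lemma 4.1 (i) alone** (`riemannian_penrose_inequality_smooth_of_outermost` with the
boundary maximum principle discharged, `minimalSurface_boundary_maximumPrinciple_holds`):
`exteriorRegion_structure → riemannian_penrose_inequality_outermost →
riemannian_penrose_inequality_smooth`. [cite: BrayRPI2001, Thm. 19 (p. 240)]
[cite: HuiskenIlmanenIMCF2001, §4, Lemma 4.1 (i)] -/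
theorem riemannian_penrose_inequality_smooth_of_outermost' (h1 : exteriorRegion_structure)
    (h : riemannian_penrose_inequality_outermost) : riemannian_penrose_inequality_smooth :=
  riemannian_penrose_inequality_smooth_of_outermost h1
    minimalSurface_boundary_maximumPrinciple_holds h

/-- **gr.S09, rigidity (corrected statement), on the two remaining named facts**:
`exteriorRegion_structure → Bray2001_penrose_rigidity_exteriorRegion →
riemannian_penrose_rigidity_smooth` (`riemannian_penrose_rigidity_smooth_of_graphMaximumPrinciple`
with the geometric maximum principle for minimal graphs supplied by its proof
`minimalGraph_strongMaximumPrinciple_holds` of `MinimalGraphOperatorHolds.lean`). Unfolded: under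
the hypotheses of `riemannian_penrose_rigidity_smooth` the horizon `S` (smooth unit normal)
bounds `V = S.exterior`; Lemma 4.1 (i) gives the exterior component `U = V ∖ K(V)` of the end,
bounded by embedded minimal spheres in `closure V`; spheres inside `V` are excluded by
`IsMinimalSurfaceFree` and spheres touching `S` are components of `S` by the (now proved)
boundary maximum principle, so `U = V`, `∂U = S`, and every compact immersed minimal surface in
`closure V` lies in `S`; the case of equality of Thm. 19 for the exterior region `V`, applied to
the nonempty horizon `S ⊆ ∂V` with `√(|S|/16π) = E`, is the isometry of `S.exterior` with the
Schwarzschild exterior `({E/2 < ‖y‖}, (1 + E/(2‖y‖))⁴ δ)` of mass `E = e.admEnergy D`. What is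
not machine-checked below `riemannian_penrose_rigidity_smooth` is thereby exactly Huisken–Ilmanen's
Lemma 4.1 (i) and the case of equality of Bray's Thm. 19 for exterior regions (with Lemma 4.1
(ii) making the boundary outer-minimizing).
[cite: BrayRPI2001, Thm. 19 (p. 240) and Thm. 1 (p. 185), case of equality, with (12), Def. 21, (225) and §13]
[cite: HuiskenIlmanenIMCF2001, §4, Lemma 4.1 (i)–(ii)]
[cite: AnderssonGallowayHoward1998, Thm. 3.10] -/
theorem riemannian_penrose_rigidity_smooth_of_penrose_rigidity_exteriorRegion
    (h1 : exteriorRegion_structure) (h2 : Bray2001_penrose_rigidity_exteriorRegion) :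
    riemannian_penrose_rigidity_smooth :=
  riemannian_penrose_rigidity_smooth_of_graphMaximumPrinciple h1 h2
    minimalGraph_strongMaximumPrinciple_holds

/-- **gr.S09, rigidity (corrected statement): Bray's §13 line on the remaining named facts,
maximum principle discharged**: `exteriorRegion_structure → Bray2001_capacity_eq_of_penrose_eq →
Bray2001_oneSided_of_penrose_eq → Bray2001_capacity_rigidity → riemannian_penrose_rigidity_smooth`
(`riemannian_penrose_rigidity_smooth_of_capacity_rigidity_graph` with
`minimalGraph_strongMaximumPrinciple_holds`). This is the last paragraph of Bray's proof of the
case of equality (§13: equality in (226) for all `t ≥ 0` forces `ℰ(Σ⁺(0), g₀) = 2 m(0)`, and the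
case of equality of Thm. 9 makes `(M³, g)` a Schwarzschild manifold outside `Σ⁺(0)`),
machine-checked on top of those four named facts for the corrected statement.
[cite: BrayRPI2001, §13, proof of the case of equality (after Thm. 18), and Thm. 9 (§6)]
[cite: HuiskenIlmanenIMCF2001, §4, Lemma 4.1 (i)]
[cite: AnderssonGallowayHoward1998, Thm. 3.10] -/
theorem riemannian_penrose_rigidity_smooth_of_capacity_rigidity'
    (h1 : exteriorRegion_structure) (h13 : Bray2001_capacity_eq_of_penrose_eq)
    (h13' : Bray2001_oneSided_of_penrose_eq) (h9 : Bray2001_capacity_rigidity) :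
    riemannian_penrose_rigidity_smooth :=
  riemannian_penrose_rigidity_smooth_of_capacity_rigidity_graph h1 h13 h13' h9
    minimalGraph_strongMaximumPrinciple_holds


/-! ### Caveat (2026-08-15): `exteriorRegion_structure` is refuted as stated; the topological
step of the corrected reduction

**The named fact `exteriorRegion_structure` (`ExteriorRegion.lean`) is false as stated**, so
every theorem of this file taking `(h1 : exteriorRegion_structure)` — and likewise the
`h1`-lines of `OutermostHorizon.lean` / `OutermostHorizonSmooth.lean` for the inequality — is a
correct but *vacuous* implication; only the `h1`-free theorems of the printed-outermost form
(`riemannian_penrose_rigidity_outermost_of_penrose_rigidity_exteriorRegion`,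
`riemannian_penrose_rigidity_outermost_of_capacity_rigidity'`) carry content. The defect: the
fact vendors Huisken–Ilmanen's Lemma 4.1 (i) with the boundary of the exterior component
`U = V ∖ K(V)` presented as a `MinimalBoundary` — a compact surface *embedded* onto `frontier U`
with a *continuous* (indeed smooth) unit normal field, all components `2`-spheres — whereas the
source (J. Differential Geom. 59 (2001), §4, proof of Lemma 4.1: "we take the metric completion
rather than the closure because some component of `K` might be a nonseparating surface"; "the
spherical topology comes from (ii)") asserts sphericity for the boundary of the **metric
completion** `M'` of `U`, in which a nonseparating component of `∂K` appears twice and a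
**one-sided** component appears through its orientation double cover. Counterexample (the
time-symmetric slice of the `ℝP³` geon; Baker–Galloway, Comm. Math. Phys. 336 (2015) 431–440,
§3: it "has one asymptotically flat end (identical to an end in the Schwarzschild slice), and
contains a projective plane `Σ` that is covered by the unique minimal sphere `Σ̃`" of the
Schwarzschild slice; "since `Σ` is not two-sided, it is not a MOTS"): let `X` be the quotient of
the Schwarzschild slice `(ℝ³ ∖ {0}, (1 + m/2r)⁴ δ)` by the free isometric involution
`x ↦ -(m/2)² x/|x|²` (inversion in the horizon composed with the antipodal map), `D = (h, 0)`
the descended data, `e` its Schwarzschild end and `V = ⊤` (`MinimalBoundary.univ`); `X` is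
complete, connected, `IsExteriorRegion e ⊤` and `IsMetricAsymptoticallyFlat e D 1` hold. Every
compact immersed minimal surface of `X` lifts to one of the Schwarzschild slice, which lies in
the horizon (comparison with the mean-convex foliation by coordinate spheres), so
`trappedSet D.h ⊤ = P`, the one-sided totally geodesic `ℝP² = Σ`, which is compact — but
`frontier (⊤ ∖ P) = P` carries no continuous unit normal (a continuous unit normal along an
embedding onto `P` would lift to `±` the outward horizon normal on the connected double cover
`S²`, which the deck involution reverses), so no `MinimalBoundary D.h (⊤ ∖ P)` exists and the
existential conclusion fails (as does its sphere clause). The statements about a *given*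
exterior region `(U, B : MinimalBoundary)` — `Bray2001_penrose_rigidity_exteriorRegion`,
`Bray2001_penrose_inequality_exteriorRegion`, `riemannian_penrose_inequality_exteriorRegion`,
the §13 facts — are not affected, nor is the corrected statement
`riemannian_penrose_rigidity_smooth` itself: with `IsMinimalSurfaceFree` (no *two-sided* compact
embedded minimal surface in `V = S.exterior`) one-sided minimal projective planes `Pᵢ ⊆ V` are
not excluded a priori, but (1) every component of `S` still lies in `∂U` and `V ∖ U = ⋃ Pᵢ`,
because compact one-sided surfaces do not separate a connected open set — the purely
topological step proved below — and (2) Bray's Thm. 19 for `M'`, whose outer-minimizing boundary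
has area `|∂M'| = Σⱼ multⱼ |Sⱼ| + 2 Σᵢ |Pᵢ| ≥ |S|`, turns the equality `16π E² = |S|` into
"no `Pᵢ`, multiplicity one, `U = V`", after which the case of equality applies as before. Step
(2) needs Lemma 4.1 (i) and Thm. 19 re-vendored with an *immersed* boundary parametrization of
`∂M'` (area counted with multiplicity); those statements are not in the tree, and this file,
which introduces no named facts, does not add them.

The topological step (1), in the form in which the corrected reduction will consume it: let `V`
be preconnected, `U, W ⊆ V` disjoint open sets (`U` the exterior component, `W = V ∖ closure U`),
and suppose the rest `V ∖ (U ∪ W)` (the one-sided components `Pᵢ = Kᵢ` of `V ∩ ∂U`) is covered by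
open sets `Tᵢ` (tubular neighbourhoods of the `Pᵢ` inside `V`, shrunk to miss the other `Pⱼ`)
each of whose punctured parts `Tᵢ ∩ (U ∪ W)` is preconnected (one-sidedness: the complement of
`Pᵢ` in its tubular neighbourhood, an interval bundle with connected boundary double cover, is
connected) and meets `U` (`Pᵢ ⊆ ∂U`); then `W = ∅` if `U ≠ ∅`
(`eq_empty_of_isPreconnected_of_inter_union_isPreconnected`), i.e. `V ⊆ closure U`
(`subset_closure_of_isPreconnected_of_diff_frontier_isPreconnected`). -/

section OneSidedComponents

variable {Y : Type*} [TopologicalSpace Y]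

/-- **Compact one-sided surfaces do not separate** (the topological step of the corrected
reduction, abstract form). Let `V` be a preconnected set, `U, W ⊆ V` disjoint open sets with `U`
nonempty, and suppose `V ∖ (U ∪ W)` is covered by open sets `T i` such that each
`T i ∩ (U ∪ W)` is preconnected and meets `U`. Then `W = ∅`: each `T i ∩ (U ∪ W)`, being
preconnected, covered by the disjoint open sets `U`, `W` and meeting `U`, lies in `U`, so
`U ∪ ⋃ i, T i` is an open set disjoint from `W` which together with `W` covers `V`; by
preconnectedness of `V ∋ U ≠ ∅`, `V ∩ W = ∅`. (Used with `T i` a tubular neighbourhood of a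
one-sided component of `V ∩ ∂U`, whose punctured part is connected.) [folklore] -/
theorem eq_empty_of_isPreconnected_of_inter_union_isPreconnected
    {ι : Sort*} {V U W : Set Y} {T : ι → Set Y}
    (hV : IsPreconnected V) (hU : IsOpen U) (hW : IsOpen W) (hUW : Disjoint U W)
    (hUV : U ⊆ V) (hWV : W ⊆ V) (hne : U.Nonempty)
    (hK : V \ (U ∪ W) ⊆ ⋃ i, T i) (hTo : ∀ i, IsOpen (T i))
    (hTc : ∀ i, IsPreconnected (T i ∩ (U ∪ W))) (hTU : ∀ i, (T i ∩ U).Nonempty) :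
    W = ∅ := by
  -- each punctured neighbourhood lies in `U`
  have hTsub : ∀ i, T i ∩ (U ∪ W) ⊆ U := fun i ↦ by
    obtain ⟨x, hxT, hxU⟩ := hTU i
    exact (hTc i).subset_left_of_subset_union hU hW hUW inter_subset_right
      ⟨x, ⟨hxT, Or.inl hxU⟩, hxU⟩
  have hTW : ∀ i, Disjoint (T i) W := fun i ↦
    Set.disjoint_left.2 fun x hxT hxW ↦
      (Set.disjoint_left.1 hUW) (hTsub i ⟨hxT, Or.inr hxW⟩) hxW
  -- the open set `U ∪ ⋃ i, T i` and `W` cover `V` disjointly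
  have hU'o : IsOpen (U ∪ ⋃ i, T i) := hU.union (isOpen_iUnion hTo)
  have hcover : V ⊆ (U ∪ ⋃ i, T i) ∪ W := by
    intro x hx
    by_cases h : x ∈ U ∪ W
    · rcases h with h | h
      · exact Or.inl (Or.inl h)
      · exact Or.inr h
    · exact Or.inl (Or.inr (hK ⟨hx, h⟩))
  have hdisj : Disjoint (U ∪ ⋃ i, T i) W :=
    Set.disjoint_union_left.2 ⟨hUW, Set.disjoint_iUnion_left.2 hTW⟩
  -- preconnectedness of `V`
  by_contra hWne
  obtain ⟨w, hw⟩ := Set.nonempty_iff_ne_empty.2 hWne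
  obtain ⟨u, hu⟩ := hne
  obtain ⟨x, -, hxU', hxW⟩ :=
    hV _ W hU'o hW hcover ⟨u, hUV hu, Or.inl hu⟩ ⟨w, hWV hw, hw⟩
  exact Set.disjoint_left.1 hdisj hxU' hxW

/-- **Compact one-sided surfaces do not separate**, closure form: let `V` be an open preconnected
set, `U ⊆ V` a nonempty open subset, and suppose `V ∩ frontier U` is covered by open sets
`T i ⊆ V` each meeting `frontier U` and each with preconnected punctured part
`T i ∖ frontier U`. Then `V ⊆ closure U` (apply
`eq_empty_of_isPreconnected_of_inter_union_isPreconnected` with `W = V ∖ closure U`, for which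
`V ∖ (U ∪ W) = V ∩ frontier U` and `T i ∩ (U ∪ W) = T i ∖ frontier U`). In the corrected reduction
of `riemannian_penrose_rigidity_smooth`: `V = S.exterior`, `U` the exterior component of the end,
`V ∩ ∂U` the union of the one-sided minimal components, `T i` their tubular neighbourhoods in `V`;
conclusion `S = frontier V ⊆ closure U`, hence `S ⊆ ∂U`. [folklore] -/
theorem subset_closure_of_isPreconnected_of_diff_frontier_isPreconnected
    {ι : Sort*} {V U : Set Y} {T : ι → Set Y}
    (hVo : IsOpen V) (hV : IsPreconnected V) (hU : IsOpen U) (hUV : U ⊆ V) (hne : U.Nonempty)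
    (hK : V ∩ frontier U ⊆ ⋃ i, T i) (hTo : ∀ i, IsOpen (T i)) (hTV : ∀ i, T i ⊆ V)
    (hTc : ∀ i, IsPreconnected (T i \ frontier U)) (hTU : ∀ i, (T i ∩ frontier U).Nonempty) :
    V ⊆ closure U := by
  have hfr : frontier U = closure U \ U := by
    rw [frontier, hU.interior_eq]
  -- `W = V ∖ closure U`
  have hWo : IsOpen (V \ closure U) := hVo.sdiff isClosed_closure
  have hUW : Disjoint U (V \ closure U) :=
    Set.disjoint_left.2 fun x hxU hxW ↦ hxW.2 (subset_closure hxU)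
  have hK' : V \ (U ∪ (V \ closure U)) ⊆ ⋃ i, T i := by
    intro x ⟨hxV, hx⟩
    simp only [mem_union, not_or, Set.mem_sdiff, not_and, not_not] at hx
    exact hK ⟨hxV, hfr ▸ ⟨hx.2 hxV, hx.1⟩⟩
  -- the punctured parts
  have hpunct : ∀ i, T i ∩ (U ∪ (V \ closure U)) = T i \ frontier U := by
    intro i
    ext x
    simp only [mem_inter_iff, mem_union, Set.mem_sdiff, hfr]
    constructor
    · rintro ⟨hxT, hx | ⟨-, hx⟩⟩
      · exact ⟨hxT, fun h ↦ h.2 hx⟩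
      · exact ⟨hxT, fun h ↦ hx h.1⟩
    · rintro ⟨hxT, hx⟩
      by_cases hc : x ∈ closure U
      · exact ⟨hxT, Or.inl (by_contra fun hxU ↦ hx ⟨hc, hxU⟩)⟩
      · exact ⟨hxT, Or.inr ⟨hTV i hxT, hc⟩⟩
  have hTc' : ∀ i, IsPreconnected (T i ∩ (U ∪ (V \ closure U))) := fun i ↦
    (hpunct i).symm ▸ hTc i
  -- an open set meeting `frontier U ⊆ closure U` meets `U`
  have hTU' : ∀ i, (T i ∩ U).Nonempty := fun i ↦ by
    obtain ⟨x, hxT, hxfr⟩ := hTU i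
    have hxcl : x ∈ closure U := (hfr ▸ hxfr).1
    obtain ⟨y, hyT, hyU⟩ := mem_closure_iff.1 hxcl (T i) (hTo i) hxT
    exact ⟨y, hyT, hyU⟩
  have hW := eq_empty_of_isPreconnected_of_inter_union_isPreconnected hV hU hWo hUW hUV
    sdiff_subset hne hK' hTo hTc' hTU'
  intro x hxV
  by_contra hx
  have : x ∈ V \ closure U := ⟨hxV, hx⟩
  rw [hW] at this
  exact this

end OneSidedComponents
end Literature.Geometry.Lorentzian

end
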